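import Mathlib.LinearAlgebra.Matrix.Block
import Literature.NumberTheory.Automorphic.ReciprocityGLn
import Literature.NumberTheory.GaloisRepresentations.GaloisRep
import HarnessLib

/-!
# Trianguline representations: `(φ, Γ)`-module data and `TriangulineAt`

Let `F` be a finite extension of `ℚ_p`, `E/ℚ_p` a finite coefficient field, `𝓡 = 𝓡_{E,F}` the
Robba ring of `F` with coefficients in `E` (Kedlaya–Pottharst–Xiao, *KPX*, Def. 2.2.2: commuting
`E`-linear actions of a Frobenius `φ` and of `Γ_F = Gal(F(μ_{p^∞})/F)`), and
`D_rig^†(ρ)` Berger's `(φ, Γ_F)`-module over `𝓡` of a continuous `ρ : Γ_F = Gal(F̄/F) → GL_n(E)`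
(Berger 2002; KPX Thm. 2.2.17; Hansen Thm. 6.1.2: fully faithful, exact). Rank-one
`(φ, Γ_F)`-modules over `𝓡` are the `𝓡(δ)`, `δ : F× → E×` a continuous character, and `δ` is
unique (KPX Construction 6.2.4, Thm. 6.2.14; Hansen Thm. 6.1.3). An ordered tuple
`δ = (δ₁, …, δₙ)` is a **parameter** of `ρ` if `D_rig^†(ρ)` has an increasing filtration
`0 = Fil⁰ ⊂ Fil¹ ⊂ ⋯ ⊂ Filⁿ = D_rig^†(ρ)` by `(φ, Γ_F)`-stable `𝓡`-free direct summands with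
`Filⁱ/Filⁱ⁻¹ ≅ 𝓡(δᵢ)`; `ρ` is **trianguline** if it has a parameter, after perhaps enlarging `E`
(Colmez 2008 for `F = ℚ_p`; KPX Def. 6.3.1; Hansen §6.1 and Def. 6.1.4; Breuil–Hellmann–Schraen
2016 §2.2). For a number field `K`, `ρ : Γ_K → GL_n(ℚ̄_p)` and `v ∣ p`, "`ρ` is trianguline at
`v`" means `ρ|_{Γ_{K_v}}` is (Hansen §1.2, Conj. 1.2.3; §1.4 conventions).

Neither Mathlib nor this tree has the Robba ring (field of norms, `π_F`), overconvergence
(Cherbonnier–Colmez) or Kedlaya's slope filtrations, so — exactly as for Fontaine's period rings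
(`PeriodRingData`, file `PAdicHodge`) and for `WD ∘ D_pst` (`PstWeilDeligneData`) — the genuine
objects enter as a DATUM whose type this file fixes, and every predicate is relative to it:

* `PhiGammaRing Γ E`: a nontrivial commutative `E`-algebra `R` with an `E`-linear action of a
  group `Γ` by ring automorphisms and a commuting `E`-algebra endomorphism `frob` (KPX Def. 2.2.2).
* `FramedPhiGammaModule 𝓡 n`: a `(φ, Γ)`-module FREE OF RANK `n` over `𝓡.R` GIVEN WITH A BASIS,
  i.e. the matrices `matPhi ∈ GL_n(R)` of `φ` (invertible: the linearisation `φ*D → D` is an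
  isomorphism, KPX Def. 2.2.6; Hansen Def. 6.1.1 "`𝓡 · φ(D) = D`") and `matGamma γ ∈ GL_n(R)`,
  subject to the semilinear cocycle rule `G(γγ') = G(γ) · γ(G(γ'))` and the commutation rule
  `P · φ(G(γ)) = G(γ) · γ(P)` (entrywise actions on matrices). `conj U` is the change of basis
  `e ↦ e U` (`P ↦ U⁻¹ P φ(U)`, `G(γ) ↦ U⁻¹ G(γ) γ(U)`), `IsIso` the resulting isomorphism relation.
  Working with bases loses nothing: `D_rig^†(ρ)` and the `𝓡(δ)` are free (KPX Rem. 2.2.16 and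
  Thm. 6.2.14; Hansen Def. 6.1.1), and a filtration of a free module by free direct summands with
  free rank-one graded pieces has an adapted basis. In an adapted basis "trianguline with
  parameter `δ`" reads: all matrices are upper triangular (`Matrix.BlockTriangular · id`) with the
  scalars of `𝓡(δᵢ)` on the diagonal — `IsTriangularWith`, `IsTriangulableWith` (∃ basis). This is
  the etymology of Colmez's word. Saturation of the `Filⁱ` is automatic (BHS 2016 §2.2,
  "nécessairement facteurs directs").
* `PhiGammaModuleData p F E`: for the acting group `Γ_F^abs = Field.absoluteGaloisGroup F` (acting
  THROUGH its cyclotomic quotient `Γ_F`: the kernel `H_F` of the `p`-adic cyclotomic character acts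
  trivially on the ring and on every module, fields `smul_eq_self`, `Drig_matGamma_eq_one`,
  `charMod_matGamma_eq_one` — this pins the cyclotomic theory, as opposed to Lubin–Tate
  `(φ_q, Γ_LT)`-modules): a `PhiGammaRing` (INTENDED `𝓡_{E,F}`), the rule
  `Drig : FramedGaloisRep F E n → FramedPhiGammaModule _ n` (INTENDED: `D_rig^†(ρ)` in a chosen
  basis) with functoriality in the frame (`Drig_conj`), full faithfulness on isomorphism
  classes (`Drig_injective`, KPX Thm. 2.2.17) and `Drig 1 ≅ trivial` (`Drig_one`), and the
  rank-one objects `charMod δ` (INTENDED: KPX's `𝓡_{E,F}(δ)` in a chosen basis) with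
  `charMod 1 ≅ trivial`, uniqueness of `δ` (`charMod_injective`, KPX Thm. 6.2.14 (2); BHS 2016
  §2.2) and `D_rig^†(character) ≅ some 𝓡(δ)` (`Drig_rank_one`, KPX Thm. 6.2.14 (1)).
  PLACEHOLDER STATUS as for `PstWeilDeligneData`: the fields are abstract;
  the named fact `PhiGammaModuleData.nonempty` records that the genuine objects inhabit the type
  and is the target of the definition items "construct `𝓡_{E,F}`", "construct `D_rig^†`".
* Predicates: `PhiGammaModuleData.IsTriangulineWith 𝔇 D δ`, `FramedGaloisRep.IsTriangulineWith
  𝔇 ρ δ` (`δ` is a parameter of `ρ`, parameters `E`-valued), `FramedGaloisRep.IsTrianguline`,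
  `FramedGaloisRep.parameters`; and for a number field `K`, `ρ : Γ_K → GL_n(ℚ̄_p)`, `v` a finite
  place and a family `𝔇` of data for `K_v = v.adicCompletion K` over the finite `E ⊆ ℚ̄_p`:
  `FramedGaloisRep.TriangulineAt v 𝔇 ρ` — `ρ|_{Γ_{K_v}}` (accepted `FramedGaloisRep.toLocal`)
  has a model `rE` over some finite `E/ℚ_p` (accepted `HasQlModel`) which is trianguline for
  `𝔇 E` — and `FramedGaloisRep.HasParameterAt v 𝔇 ρ δ` for `ℚ̄_p`-valued parameters. The
  existential over `E` is KPX's "after perhaps enlarging `L`" / Hansen's "`L` sufficiently large".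
* Proved API: `conj_one`, `conj_conj`, `IsIso.refl/symm/trans`, `gammaOp_mul` and `phiOp_gammaOp`
  (the semilinear operators `x ↦ P φ(x)`, `x ↦ G(γ) γ(x)` on `Rⁿ` form a commuting action —
  validating the matrix conventions), invariance of triangulability under `IsIso`, frame
  invariance `isTriangulineWith_conj_iff`, and non-vacuity for EVERY datum: the trivial
  representation is trianguline with parameter `(1, …, 1)` (`isTriangulineWith_one`) and every
  character is trianguline (`isTrianguline_of_rank_one`).

## Deliberately not here

The topology of `𝓡` and continuity of the `Γ`-action (KPX Def. 2.2.12, Hansen Def. 6.1.1) are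
properties of the intended instance not consumed by the predicates (all modules come from the
datum); likewise étaleness/slopes, the cohomology `H^i_{φ,γ}`, the comparison of `charMod` with
`Drig` on characters (needs the local Artin map), tensor products/twists, base change in `E`
(a tower structure over the family can be added on top of `TriangulineAt`'s bare family), and
the facts "crystalline ⇒ trianguline", "twist-stability", "semisimplification-insensitivity"
(separate fact items; they need the datum enriched by exactness/tensor structure).

## References

* K. S. Kedlaya, J. Pottharst, L. Xiao, *Cohomology of arithmetic families of
  `(φ, Γ)`-modules*, JAMS 27 (2014), arXiv:1203.5718: Notation 2.2.1, Def. 2.2.2, 2.2.6, 2.2.12,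
  Rem. 2.2.16, Thm. 2.2.17, Notation 6.2.2, Construction 6.2.4, Thm. 6.2.14, Def. 6.3.1.
  [KedlayaPottharstXiao2014]
* D. Hansen (appendix J. Newton), *Universal eigenvarieties, trianguline Galois representations,
  and `p`-adic Langlands functoriality*, Crelle 730 (2017), arXiv:1412.1533: §1.2 Conj. 1.2.3,
  §1.4, §6.1 Def. 6.1.1, Thm. 6.1.2, Thm. 6.1.3, Def. 6.1.4. [HansenUniversalEigenvarieties2017]
* C. Breuil, E. Hellmann, B. Schraen, *Une interprétation modulaire de la variété trianguline*,
  Math. Ann. 367 (2017), arXiv:1411.7260, §2.2 (paramètre, `X_tri`). [BreuilHellmannSchraen2016]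
* L. Berger, *Représentations `p`-adiques et équations différentielles*, Invent. Math. 148
  (2002) (`D_rig^†`). [BergerLaurent2002]
* P. Colmez, *Représentations triangulines de dimension 2*, Astérisque 319 (2008), 213–258 (the
  notion, `F = ℚ_p`; attribution as printed in KPX §6.3; source not held, acq-02316).
-/

noncomputable section

open scoped NumberField
open Field IsDedekindDomain Matrix

namespace Literature.NumberTheory.GaloisRepresentations

universe u v w

/-! ### `(φ, Γ)`-rings -/

/-- A **`(φ, Γ)`-ring** with coefficients `E` (any commutative ring: a field `E/ℚ_p` finite, or an
affinoid / Artinian `E`-algebra `A` for the relative Robba rings `𝓡_A`): a nontrivial commutative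
`E`-algebra `R` (playing the Robba ring `𝓡_{E,F} = 𝓡_F ⊗_{ℚ_p} E`) with an `E`-linear action of the group `Γ` by ring
automorphisms (`MulSemiringAction`, `SMulCommClass Γ E R`) and an `E`-algebra endomorphism
`frob` (the Frobenius `φ`) commuting with `Γ`. KPX Def. 2.2.2 ("commuting `A`-linear actions of
`Γ_K` and of an operator `φ`"); Hansen §6.1.
[cite: KedlayaPottharstXiao2014, Def. 2.2.2] -/
structure PhiGammaRing (Γ : Type u) [Group Γ] (E : Type v) [CommRing E] :
    Type (max u v (w + 1)) where
  /-- The ring `R` (intended: the Robba ring `𝓡_{E,F}`). -/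
  R : Type w
  /-- `R` is a commutative ring. -/
  [commRing : CommRing R]
  /-- `R` is nontrivial. -/
  [nontrivial : Nontrivial R]
  /-- `R` is an `E`-algebra. -/
  [algebra : Algebra E R]
  /-- `Γ` acts on `R` by ring automorphisms. -/
  [action : MulSemiringAction Γ R]
  /-- The action is `E`-linear. -/
  [smulComm : SMulCommClass Γ E R]
  /-- The Frobenius `φ`, an `E`-algebra endomorphism of `R`. -/
  frob : R →ₐ[E] R
  /-- `φ` commutes with the action of `Γ`. -/
  frob_smul : ∀ (γ : Γ) (r : R), frob (γ • r) = γ • frob r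

namespace PhiGammaRing

attribute [instance] commRing nontrivial algebra action smulComm

variable {Γ : Type u} [Group Γ] {E : Type v} [CommRing E] (𝓡 : PhiGammaRing.{u, v, w} Γ E)

/-- The ring endomorphism `r ↦ γ • r` of `R` (Mathlib `MulSemiringAction.toRingHom`). [folklore] -/
abbrev gammaHom (γ : Γ) : 𝓡.R →+* 𝓡.R := MulSemiringAction.toRingHom Γ 𝓡.R γ

/-- `φ` applied entrywise to invertible matrices: `GL_n(φ) : GL_n(R) →* GL_n(R)`. [folklore] -/
def phiGL (n : ℕ) : GL (Fin n) 𝓡.R →* GL (Fin n) 𝓡.R :=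
  Matrix.GeneralLinearGroup.map (𝓡.frob : 𝓡.R →+* 𝓡.R)

/-- `γ` applied entrywise to invertible matrices: `GL_n(γ) : GL_n(R) →* GL_n(R)`. [folklore] -/
def gammaGL (n : ℕ) (γ : Γ) : GL (Fin n) 𝓡.R →* GL (Fin n) 𝓡.R :=
  Matrix.GeneralLinearGroup.map (𝓡.gammaHom γ)

/-- Entries of `phiGL`. [folklore] -/
@[simp] lemma phiGL_apply {n : ℕ} (U : GL (Fin n) 𝓡.R) (i j : Fin n) :
    𝓡.phiGL n U i j = 𝓡.frob (U i j) := rfl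

/-- Entries of `gammaGL`. [folklore] -/
@[simp] lemma gammaGL_apply {n : ℕ} (γ : Γ) (U : GL (Fin n) 𝓡.R) (i j : Fin n) :
    𝓡.gammaGL n γ U i j = γ • U i j := rfl

/-- The underlying matrix of `phiGL U` is `U` with `φ` applied entrywise. [folklore] -/
lemma coe_phiGL {n : ℕ} (U : GL (Fin n) 𝓡.R) :
    ((𝓡.phiGL n U : GL (Fin n) 𝓡.R) : Matrix (Fin n) (Fin n) 𝓡.R) =
      (U : Matrix (Fin n) (Fin n) 𝓡.R).map 𝓡.frob := rfl

/-- The underlying matrix of `gammaGL γ U` is `U` with `γ` applied entrywise. [folklore] -/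
lemma coe_gammaGL {n : ℕ} (γ : Γ) (U : GL (Fin n) 𝓡.R) :
    ((𝓡.gammaGL n γ U : GL (Fin n) 𝓡.R) : Matrix (Fin n) (Fin n) 𝓡.R) =
      (U : Matrix (Fin n) (Fin n) 𝓡.R).map (𝓡.gammaHom γ) := rfl

/-- `GL_n(γγ') = GL_n(γ) ∘ GL_n(γ')`. [folklore] -/
lemma gammaGL_mul {n : ℕ} (γ γ' : Γ) (U : GL (Fin n) 𝓡.R) :
    𝓡.gammaGL n (γ * γ') U = 𝓡.gammaGL n γ (𝓡.gammaGL n γ' U) := by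
  ext i j
  simp [mul_smul]

/-- `GL_n(1) = id`. [folklore] -/
@[simp] lemma gammaGL_one {n : ℕ} (U : GL (Fin n) 𝓡.R) : 𝓡.gammaGL n 1 U = U := by
  ext i j
  simp

/-- `φ` and `γ` commute on matrices (from `frob_smul`). [folklore] -/
lemma phiGL_gammaGL {n : ℕ} (γ : Γ) (U : GL (Fin n) 𝓡.R) :
    𝓡.phiGL n (𝓡.gammaGL n γ U) = 𝓡.gammaGL n γ (𝓡.phiGL n U) := by
  ext i j
  simp [𝓡.frob_smul]

end PhiGammaRing

/-! ### Framed `(φ, Γ)`-modules (free `(φ, Γ)`-modules with a basis) -/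

/-- A **framed `(φ, Γ)`-module of rank `n`** over the `(φ, Γ)`-ring `𝓡`: a `(φ, Γ)`-module
structure on the free module `Rⁿ` with its standard basis `e`, recorded by the matrix
`matPhi = P ∈ GL_n(R)` of the `φ`-semilinear endomorphism (`φ_D(e_j) = Σ_i P_{ij} e_i`;
invertible because the linearisation `φ*D → D` is an isomorphism — KPX Def. 2.2.6, Hansen
Def. 6.1.1 "`𝓡 · φ(D) = D`") and the matrices `matGamma γ = G(γ) ∈ GL_n(R)` of the
`γ`-semilinear automorphisms, subject to: `γ ↦ (x ↦ G(γ) γ(x))` is an action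
(`matGamma_mul`: `G(γγ') = G(γ) · γ(G(γ'))`) commuting with `x ↦ P φ(x)` (`matPhi_mul`:
`P · φ(G(γ)) = G(γ) · γ(P)`); see `gammaOp_mul`, `phiOp_gammaOp`. Every `(φ, Γ_K)`-module in
the sense of Hansen Def. 6.1.1 (finite free over `𝓡_K ⊗ L`, commuting semilinear `φ`, `Γ_K`)
becomes one after choosing a basis; continuity of `Γ → End(D)` is not recorded (module
docstring). [cite: HansenUniversalEigenvarieties2017, Def. 6.1.1] -/
@[ext]
structure FramedPhiGammaModule {Γ : Type u} [Group Γ] {E : Type v} [CommRing E]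
    (𝓡 : PhiGammaRing.{u, v, w} Γ E) (n : ℕ) : Type (max u w) where
  /-- The matrix `P` of `φ` in the given basis. -/
  matPhi : GL (Fin n) 𝓡.R
  /-- The matrices `G(γ)` of the elements of `Γ` in the given basis. -/
  matGamma : Γ → GL (Fin n) 𝓡.R
  /-- Cocycle rule of a semilinear action: `G(γγ') = G(γ) · γ(G(γ'))`. -/
  matGamma_mul : ∀ γ γ' : Γ, matGamma (γ * γ') = matGamma γ * 𝓡.gammaGL n γ (matGamma γ')
  /-- `φ` commutes with `Γ`: `P · φ(G(γ)) = G(γ) · γ(P)`. -/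
  matPhi_mul : ∀ γ : Γ, matPhi * 𝓡.phiGL n (matGamma γ) = matGamma γ * 𝓡.gammaGL n γ matPhi

namespace FramedPhiGammaModule

variable {Γ : Type u} [Group Γ] {E : Type v} [CommRing E] {𝓡 : PhiGammaRing.{u, v, w} Γ E} {n : ℕ}

/-- The `φ`-semilinear endomorphism of `Rⁿ` in coordinates: `x ↦ P · φ(x)`. [folklore] -/
def phiOp (D : FramedPhiGammaModule 𝓡 n) (x : Fin n → 𝓡.R) : Fin n → 𝓡.R :=
  (D.matPhi : Matrix (Fin n) (Fin n) 𝓡.R) *ᵥ (𝓡.frob ∘ x)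

/-- The `γ`-semilinear automorphism of `Rⁿ` in coordinates: `x ↦ G(γ) · γ(x)`. [folklore] -/
def gammaOp (D : FramedPhiGammaModule 𝓡 n) (γ : Γ) (x : Fin n → 𝓡.R) : Fin n → 𝓡.R :=
  (D.matGamma γ : Matrix (Fin n) (Fin n) 𝓡.R) *ᵥ (γ • x)

/-- `γ` applied entrywise commutes past `*ᵥ`: `γ(M x) = γ(M) γ(x)`. [folklore] -/
lemma smul_mulVec (γ : Γ) (M : Matrix (Fin n) (Fin n) 𝓡.R) (x : Fin n → 𝓡.R) :
    γ • (M *ᵥ x) = M.map (𝓡.gammaHom γ) *ᵥ (γ • x) := by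
  ext i
  exact RingHom.map_mulVec (𝓡.gammaHom γ) M x i

/-- `φ` applied entrywise commutes past `*ᵥ`: `φ(M x) = φ(M) φ(x)`. [folklore] -/
lemma frob_comp_mulVec (M : Matrix (Fin n) (Fin n) 𝓡.R) (x : Fin n → 𝓡.R) :
    𝓡.frob ∘ (M *ᵥ x) = M.map 𝓡.frob *ᵥ (𝓡.frob ∘ x) := by
  ext i
  exact RingHom.map_mulVec (𝓡.frob : 𝓡.R →+* 𝓡.R) M x i

/-- `G(1) = 1` (from the cocycle rule). [folklore] -/
lemma matGamma_one (D : FramedPhiGammaModule 𝓡 n) : D.matGamma 1 = 1 := by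
  have h := D.matGamma_mul 1 1
  rw [𝓡.gammaGL_one, mul_one] at h
  calc D.matGamma 1 = (D.matGamma 1)⁻¹ * (D.matGamma 1 * D.matGamma 1) := by group
    _ = 1 := by rw [← h, inv_mul_cancel]

/-- The operators `gammaOp` form an action of `Γ` on `Rⁿ` (this is what `matGamma_mul`
encodes). [folklore] -/
lemma gammaOp_mul (D : FramedPhiGammaModule 𝓡 n) (γ γ' : Γ) (x : Fin n → 𝓡.R) :
    D.gammaOp (γ * γ') x = D.gammaOp γ (D.gammaOp γ' x) := by
  simp only [gammaOp, D.matGamma_mul, Matrix.GeneralLinearGroup.coe_mul, smul_mulVec,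
    Matrix.mulVec_mulVec, mul_smul]
  rfl

/-- `phiOp` commutes with every `gammaOp` (this is what `matPhi_mul` encodes). [folklore] -/
lemma phiOp_gammaOp (D : FramedPhiGammaModule 𝓡 n) (γ : Γ) (x : Fin n → 𝓡.R) :
    D.phiOp (D.gammaOp γ x) = D.gammaOp γ (D.phiOp x) := by
  have hx : 𝓡.frob ∘ (γ • x) = γ • (𝓡.frob ∘ x) := by
    ext i
    exact 𝓡.frob_smul γ (x i)
  have h := congrArg (fun U : GL (Fin n) 𝓡.R => (U : Matrix (Fin n) (Fin n) 𝓡.R)) (D.matPhi_mul γ)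
  simp only [Matrix.GeneralLinearGroup.coe_mul] at h
  simp only [phiOp, gammaOp, smul_mulVec, frob_comp_mulVec, Matrix.mulVec_mulVec, hx]
  exact congrArg (fun M : Matrix (Fin n) (Fin n) 𝓡.R => M *ᵥ (γ • (𝓡.frob ∘ x))) h

/-- **Change of basis** `e ↦ e · U` (`U ∈ GL_n(R)`): the same `(φ, Γ)`-module in the new
basis has matrices `U⁻¹ P φ(U)` and `U⁻¹ G(γ) γ(U)`. [folklore] -/
def conj (D : FramedPhiGammaModule 𝓡 n) (U : GL (Fin n) 𝓡.R) : FramedPhiGammaModule 𝓡 n where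
  matPhi := U⁻¹ * D.matPhi * 𝓡.phiGL n U
  matGamma γ := U⁻¹ * D.matGamma γ * 𝓡.gammaGL n γ U
  matGamma_mul γ γ' := by
    rw [D.matGamma_mul, map_mul, map_mul, map_inv, 𝓡.gammaGL_mul]
    group
  matPhi_mul γ := by
    calc U⁻¹ * D.matPhi * 𝓡.phiGL n U * 𝓡.phiGL n (U⁻¹ * D.matGamma γ * 𝓡.gammaGL n γ U)
        = U⁻¹ * (D.matPhi * 𝓡.phiGL n (D.matGamma γ)) * 𝓡.phiGL n (𝓡.gammaGL n γ U) := by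
          simp only [map_mul, map_inv]; group
      _ = U⁻¹ * (D.matGamma γ * 𝓡.gammaGL n γ D.matPhi) * 𝓡.gammaGL n γ (𝓡.phiGL n U) := by
          rw [D.matPhi_mul, 𝓡.phiGL_gammaGL]
      _ = U⁻¹ * D.matGamma γ * 𝓡.gammaGL n γ U * 𝓡.gammaGL n γ (U⁻¹ * D.matPhi * 𝓡.phiGL n U) := by
          simp only [map_mul, map_inv]; group

/-- Matrices of `φ` after change of basis. [folklore] -/
@[simp] lemma conj_matPhi (D : FramedPhiGammaModule 𝓡 n) (U : GL (Fin n) 𝓡.R) :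
    (D.conj U).matPhi = U⁻¹ * D.matPhi * 𝓡.phiGL n U := rfl

/-- Matrices of `γ` after change of basis. [folklore] -/
@[simp] lemma conj_matGamma (D : FramedPhiGammaModule 𝓡 n) (U : GL (Fin n) 𝓡.R) (γ : Γ) :
    (D.conj U).matGamma γ = U⁻¹ * D.matGamma γ * 𝓡.gammaGL n γ U := rfl

/-- Changing basis by `1` does nothing. [folklore] -/
@[simp] lemma conj_one (D : FramedPhiGammaModule 𝓡 n) : D.conj 1 = D := by
  ext <;> simp

/-- Successive changes of basis compose: `(D.conj U).conj V = D.conj (U V)`. [folklore] -/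
lemma conj_conj (D : FramedPhiGammaModule 𝓡 n) (U V : GL (Fin n) 𝓡.R) :
    (D.conj U).conj V = D.conj (U * V) := by
  ext γ : 2
  · simp only [conj_matPhi, map_mul]
    group
  · simp only [conj_matGamma, map_mul]
    group

/-- Two framed `(φ, Γ)`-modules are **isomorphic** if they differ by a change of basis. [folklore] -/
def IsIso (D D' : FramedPhiGammaModule 𝓡 n) : Prop :=
  ∃ U : GL (Fin n) 𝓡.R, D' = D.conj U

/-- `IsIso` is reflexive. [folklore] -/
lemma IsIso.refl (D : FramedPhiGammaModule 𝓡 n) : D.IsIso D := ⟨1, (conj_one D).symm⟩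

/-- `IsIso` is symmetric. [folklore] -/
lemma IsIso.symm {D D' : FramedPhiGammaModule 𝓡 n} (h : D.IsIso D') : D'.IsIso D := by
  obtain ⟨U, rfl⟩ := h
  exact ⟨U⁻¹, by rw [conj_conj, mul_inv_cancel, conj_one]⟩

/-- `IsIso` is transitive. [folklore] -/
lemma IsIso.trans {D D' D'' : FramedPhiGammaModule 𝓡 n} (h : D.IsIso D') (h' : D'.IsIso D'') :
    D.IsIso D'' := by
  obtain ⟨U, rfl⟩ := h
  obtain ⟨V, rfl⟩ := h'
  exact ⟨U * V, conj_conj D U V⟩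

variable (𝓡 n) in
/-- The **trivial** framed `(φ, Γ)`-module `Rⁿ` (`P = 1`, `G(γ) = 1`): the `(φ, Γ)`-module of the
trivial representation. [folklore] -/
def trivial : FramedPhiGammaModule 𝓡 n where
  matPhi := 1
  matGamma _ := 1
  matGamma_mul _ _ := by simp
  matPhi_mul _ := by simp

/-- The matrix of `φ` of the trivial module. [folklore] -/
@[simp] lemma trivial_matPhi : (trivial 𝓡 n).matPhi = 1 := rfl

/-- The matrices of `γ` of the trivial module. [folklore] -/
@[simp] lemma trivial_matGamma (γ : Γ) : (trivial 𝓡 n).matGamma γ = 1 := rfl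

/-- `D` is **upper triangular with diagonal data `(a, c)`**: the matrix of `φ` is upper
triangular (Mathlib `Matrix.BlockTriangular · id`: entries below the diagonal vanish) with
diagonal `(a₁, …, aₙ)`, and for every `γ` the matrix of `γ` is upper triangular with diagonal
`(c₁(γ), …, cₙ(γ))`. Equivalently the standard flag `Filⁱ = ⟨e₁, …, eᵢ⟩` is `(φ, Γ)`-stable
with rank-one graded pieces `R · ēᵢ`, `φ(ēᵢ) = aᵢ ēᵢ`, `γ(ēᵢ) = cᵢ(γ) ēᵢ` (KPX Def. 6.3.1 in an
adapted basis). [cite: KedlayaPottharstXiao2014, Def. 6.3.1] -/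
def IsTriangularWith (D : FramedPhiGammaModule 𝓡 n) (a : Fin n → 𝓡.R) (c : Fin n → Γ → 𝓡.R) :
    Prop :=
  (D.matPhi : Matrix (Fin n) (Fin n) 𝓡.R).BlockTriangular id ∧
    (∀ i, (D.matPhi : Matrix (Fin n) (Fin n) 𝓡.R) i i = a i) ∧
      ∀ γ, (D.matGamma γ : Matrix (Fin n) (Fin n) 𝓡.R).BlockTriangular id ∧
        ∀ i, (D.matGamma γ : Matrix (Fin n) (Fin n) 𝓡.R) i i = c i γ

/-- `D` is **triangulable with diagonal data `(a, c)`**: in SOME basis (`conj U`) it is upper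
triangular with that diagonal, i.e. `D` has an increasing filtration by `(φ, Γ)`-stable free
direct summands whose `i`-th graded piece is the rank-one object with scalars `(aᵢ, cᵢ)`
(KPX Def. 6.3.1, "triangulation"). [cite: KedlayaPottharstXiao2014, Def. 6.3.1] -/
def IsTriangulableWith (D : FramedPhiGammaModule 𝓡 n) (a : Fin n → 𝓡.R)
    (c : Fin n → Γ → 𝓡.R) : Prop :=
  ∃ U : GL (Fin n) 𝓡.R, (D.conj U).IsTriangularWith a c

/-- Triangulability is a property of the isomorphism class. [folklore] -/
lemma IsTriangulableWith.of_isIso {D D' : FramedPhiGammaModule 𝓡 n} {a : Fin n → 𝓡.R}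
    {c : Fin n → Γ → 𝓡.R} (h : D.IsIso D') (hD' : D'.IsTriangulableWith a c) :
    D.IsTriangulableWith a c := by
  obtain ⟨U, rfl⟩ := h
  obtain ⟨V, hV⟩ := hD'
  exact ⟨U * V, by rwa [← conj_conj]⟩

/-- Isomorphic framed modules are triangulable with the same data. [folklore] -/
lemma isTriangulableWith_congr {D D' : FramedPhiGammaModule 𝓡 n} (h : D.IsIso D')
    (a : Fin n → 𝓡.R) (c : Fin n → Γ → 𝓡.R) :
    D.IsTriangulableWith a c ↔ D'.IsTriangulableWith a c :=
  ⟨fun hD => hD.of_isIso h.symm, fun hD' => hD'.of_isIso h⟩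

/-- The scalar by which `φ` acts on the basis vector of a framed RANK-ONE module. [folklore] -/
def phiScalar (L : FramedPhiGammaModule 𝓡 1) : 𝓡.R := (L.matPhi : Matrix (Fin 1) (Fin 1) 𝓡.R) 0 0

/-- The scalar by which `γ` acts on the basis vector of a framed rank-one module. [folklore] -/
def gammaScalar (L : FramedPhiGammaModule 𝓡 1) (γ : Γ) : 𝓡.R :=
  (L.matGamma γ : Matrix (Fin 1) (Fin 1) 𝓡.R) 0 0

end FramedPhiGammaModule

/-! ### The datum: Robba ring, `D_rig^†` and the rank-one objects `𝓡(δ)` -/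

section Datum

variable (p : ℕ) [Fact p.Prime] (F : Type u) [Field F] [TopologicalSpace F]
  (E : Type v) [Field E] [TopologicalSpace E] [IsTopologicalRing E]

/-- **`(φ, Γ)`-module data for the `p`-adic field `F` with coefficients in `E`** (intended:
`F/ℚ_p` and `E/ℚ_p` finite). Fields: a `(φ, Γ)`-ring for `Γ_F^abs = Field.absoluteGaloisGroup F`
(INTENDED: the Robba ring `𝓡_{E,F}` with `φ` and `Γ_F`-action, KPX Def. 2.2.2) on which the
kernel `H_F` of the `p`-adic cyclotomic character acts trivially (`smul_eq_self`: the action is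
through `Γ_F = Γ_F^abs/H_F = Gal(F(μ_{p^∞})/F)`, KPX Notation 2.2.1); the rule `Drig`
(INTENDED: Berger's `D_rig^†(ρ) = (B_rig^† ⊗ ρ)^{H_F}` in a chosen basis — free of rank `n`,
KPX Rem. 2.2.16 — on which `H_F` acts trivially, `Drig_matGamma_eq_one`), functorial in the
frame (`Drig_conj`), fully faithful on isomorphism classes (`Drig_injective`, KPX Thm. 2.2.17)
and trivial on the trivial representation (`Drig_one`); and the rank-one objects `charMod δ`
for continuous `δ : F× → E×` (INTENDED: KPX's `𝓡_{E,F}(δ)` of Construction 6.2.4 in a chosen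
basis; for `F = ℚ_p`, `φ(e) = δ(p) e`, `γ(e) = δ(χ(γ)) e`, KPX Notation 6.2.2), with
`charMod 1` trivial, `δ` determined by the isomorphism class (`charMod_injective`, KPX
Thm. 6.2.14 (2); BHS 2016 §2.2) and exhausting the `(φ, Γ)`-modules of Galois characters
(`Drig_rank_one`, KPX Thm. 6.2.14 (1)). PLACEHOLDER STATUS: see the module docstring and
`PhiGammaModuleData.nonempty`; facts needing more structure (twists, exactness) are to be stated
for structures EXTENDING this one.
[cite: KedlayaPottharstXiao2014, Thm. 2.2.17 and Construction 6.2.4] -/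
structure PhiGammaModuleData : Type (max u v (w + 1)) where
  /-- The `(φ, Γ)`-ring (intended: the Robba ring `𝓡_{E,F}`), acted on by `Γ_F^abs`. -/
  ring : PhiGammaRing.{u, v, w} (absoluteGaloisGroup F) E
  /-- `H_F = ker χ_cyc` acts trivially on the ring (the action is through `Γ_F`). -/
  smul_eq_self : ∀ σ : absoluteGaloisGroup F, GaloisRep.cyclotomicCharacter F p σ = 1 →
    ∀ r : ring.R, σ • r = r
  /-- `D_rig^†(ρ)` in a chosen basis, for `ρ : Γ_F^abs →ₜ* GL_n(E)`. -/
  Drig : ∀ {n : ℕ}, FramedGaloisRep F E n → FramedPhiGammaModule ring n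
  /-- `H_F` acts trivially on `D_rig^†(ρ)`. -/
  Drig_matGamma_eq_one : ∀ {n : ℕ} (ρ : FramedGaloisRep F E n) (σ : absoluteGaloisGroup F),
    GaloisRep.cyclotomicCharacter F p σ = 1 → (Drig ρ).matGamma σ = 1
  /-- `D_rig^†` is a functor: a change of frame of `ρ` changes `D_rig^†(ρ)` by a change of
  basis. -/
  Drig_conj : ∀ {n : ℕ} (g : GL (Fin n) E) (ρ : FramedGaloisRep F E n),
    (Drig ρ).IsIso (Drig (FramedRep.conj g ρ))
  /-- `D_rig^†` is fully faithful (KPX Thm. 2.2.17; Hansen Thm. 6.1.2): representations with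
  isomorphic `(φ, Γ)`-modules are isomorphic, i.e. differ by a change of frame. -/
  Drig_injective : ∀ {n : ℕ} (ρ ρ' : FramedGaloisRep F E n),
    (Drig ρ).IsIso (Drig ρ') → ∃ g : GL (Fin n) E, ρ' = FramedRep.conj g ρ
  /-- `D_rig^†` of the trivial rank-`n` representation is the trivial `(φ, Γ)`-module `𝓡ⁿ`. -/
  Drig_one : ∀ n : ℕ, (Drig (1 : FramedGaloisRep F E n)).IsIso (FramedPhiGammaModule.trivial ring n)
  /-- The rank-one `(φ, Γ)`-module `𝓡(δ)` of a continuous character `δ : F× → E×`, in a chosen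
  basis. -/
  charMod : (Fˣ →ₜ* Eˣ) → FramedPhiGammaModule ring 1
  /-- `H_F` acts trivially on `𝓡(δ)`. -/
  charMod_matGamma_eq_one : ∀ (δ : Fˣ →ₜ* Eˣ) (σ : absoluteGaloisGroup F),
    GaloisRep.cyclotomicCharacter F p σ = 1 → (charMod δ).matGamma σ = 1
  /-- `𝓡(1)` is the trivial rank-one `(φ, Γ)`-module. -/
  charMod_one : (charMod 1).IsIso (FramedPhiGammaModule.trivial ring 1)
  /-- The character `δ` is determined by the isomorphism class of `𝓡(δ)`. -/
  charMod_injective : ∀ δ δ' : Fˣ →ₜ* Eˣ, (charMod δ).IsIso (charMod δ') → δ = δ'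
  /-- Rank-one classification (KPX Thm. 6.2.14 (1) over `X = Max E`; Hansen Thm. 6.1.3): the
  `(φ, Γ)`-module of a character `η : Γ_F^abs →ₜ* GL_1(E)` is some `𝓡(δ)` (in the genuine
  theory `δ = η ∘ Art_F`, which needs the local Artin map and is not recorded). -/
  Drig_rank_one : ∀ η : FramedGaloisRep F E 1, ∃ δ : Fˣ →ₜ* Eˣ, (Drig η).IsIso (charMod δ)

end Datum

namespace PhiGammaModuleData

variable {p : ℕ} [Fact p.Prime] {F : Type u} [Field F] [TopologicalSpace F]
  {E : Type v} [Field E] [TopologicalSpace E] [IsTopologicalRing E]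
  (𝔇 : PhiGammaModuleData.{u, v, w} p F E)

/-- The scalar `a_δ` by which `φ` acts on the basis vector of `𝓡(δ)` (`= δ(p)` for `F = ℚ_p`). [folklore] -/
def charPhi (δ : Fˣ →ₜ* Eˣ) : 𝔇.ring.R := (𝔇.charMod δ).phiScalar

/-- The scalar `c_δ(σ)` by which `σ` acts on the basis vector of `𝓡(δ)` (`= δ(χ(σ))` for
`F = ℚ_p`). [folklore] -/
def charGamma (δ : Fˣ →ₜ* Eˣ) (σ : absoluteGaloisGroup F) : 𝔇.ring.R :=
  (𝔇.charMod δ).gammaScalar σ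

/-- The framed `(φ, Γ)`-module `D` is **trianguline with ordered parameter
`δ = (δ₁, …, δₙ)`**: in some basis all its matrices are upper triangular with the scalars of
`𝓡(δ₁), …, 𝓡(δₙ)` on the diagonal, i.e. `D` has an increasing filtration by `(φ, Γ)`-stable
free direct summands with `Filⁱ/Filⁱ⁻¹ ≅ 𝓡(δᵢ)` — a triangulation (KPX Def. 6.3.1; Hansen §6.1).
The parameters are `E`-valued (no enlargement of `E` here; cf. `FramedGaloisRep.TriangulineAt`).
[cite: KedlayaPottharstXiao2014, Def. 6.3.1] -/
def IsTriangulineWith {n : ℕ} (D : FramedPhiGammaModule 𝔇.ring n) (δ : Fin n → (Fˣ →ₜ* Eˣ)) :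
    Prop :=
  D.IsTriangulableWith (fun i => 𝔇.charPhi (δ i)) (fun i σ => 𝔇.charGamma (δ i) σ)

/-- Isomorphic framed modules are trianguline with the same parameters. [folklore] -/
lemma isTriangulineWith_congr {n : ℕ} {D D' : FramedPhiGammaModule 𝔇.ring n} (h : D.IsIso D')
    (δ : Fin n → (Fˣ →ₜ* Eˣ)) : 𝔇.IsTriangulineWith D δ ↔ 𝔇.IsTriangulineWith D' δ :=
  FramedPhiGammaModule.isTriangulableWith_congr h _ _

end PhiGammaModuleData

/-! ### Trianguline representations of `Γ_F` over `E` -/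

namespace FramedGaloisRep

section Local

variable {p : ℕ} [Fact p.Prime] {F : Type u} [Field F] [TopologicalSpace F]
  {E : Type v} [Field E] [TopologicalSpace E] [IsTopologicalRing E] {n : ℕ}

/-- **`δ = (δ₁, …, δₙ)` is a parameter of `ρ : Γ_F →ₜ* GL_n(E)`** relative to the datum `𝔇`
(intended: `D_rig^†` over the Robba ring `𝓡_{E,F}`): `D_rig^†(ρ)` admits a triangulation with
graded pieces `𝓡(δ₁), …, 𝓡(δₙ)` (in this order, `𝓡(δ₁)` the sub-object). Hansen §6.1
("parameter of `ρ`"); KPX Def. 6.3.1; BHS 2016 §2.2.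
[cite: HansenUniversalEigenvarieties2017, §6.1 and Def. 6.1.4] -/
def IsTriangulineWith (𝔇 : PhiGammaModuleData.{u, v, w} p F E) (ρ : FramedGaloisRep F E n)
    (δ : Fin n → (Fˣ →ₜ* Eˣ)) : Prop :=
  𝔇.IsTriangulineWith (𝔇.Drig ρ) δ

/-- The set `Par(ρ)` of parameters of `ρ` (Hansen §6.1). [cite: HansenUniversalEigenvarieties2017, §6.1] -/
def parameters (𝔇 : PhiGammaModuleData.{u, v, w} p F E) (ρ : FramedGaloisRep F E n) :
    Set (Fin n → (Fˣ →ₜ* Eˣ)) :=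
  {δ | ρ.IsTriangulineWith 𝔇 δ}

/-- **`ρ : Γ_F →ₜ* GL_n(E)` is trianguline** (with `E`-valued parameters) relative to `𝔇`:
`Par(ρ) ≠ ∅` (Hansen Def. 6.1.4, after Colmez). [cite: HansenUniversalEigenvarieties2017, Def. 6.1.4] -/
def IsTrianguline (𝔇 : PhiGammaModuleData.{u, v, w} p F E) (ρ : FramedGaloisRep F E n) : Prop :=
  ∃ δ : Fin n → (Fˣ →ₜ* Eˣ), ρ.IsTriangulineWith 𝔇 δ

/-- Unfolding lemma: membership in `parameters`. [folklore] -/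
@[simp] lemma mem_parameters_iff (𝔇 : PhiGammaModuleData.{u, v, w} p F E)
    (ρ : FramedGaloisRep F E n) (δ : Fin n → (Fˣ →ₜ* Eˣ)) :
    δ ∈ ρ.parameters 𝔇 ↔ ρ.IsTriangulineWith 𝔇 δ := Iff.rfl

/-- `ρ` is trianguline iff `Par(ρ)` is nonempty. [folklore] -/
lemma isTrianguline_iff_parameters_nonempty (𝔇 : PhiGammaModuleData.{u, v, w} p F E)
    (ρ : FramedGaloisRep F E n) : ρ.IsTrianguline 𝔇 ↔ (ρ.parameters 𝔇).Nonempty := Iff.rfl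

/-- **Frame invariance**: a change of frame `ρ ↦ g ρ g⁻¹` does not change the parameters
(from the functoriality axiom `Drig_conj`). [folklore] -/
lemma isTriangulineWith_conj_iff (𝔇 : PhiGammaModuleData.{u, v, w} p F E)
    (g : GL (Fin n) E) (ρ : FramedGaloisRep F E n) (δ : Fin n → (Fˣ →ₜ* Eˣ)) :
    IsTriangulineWith 𝔇 (FramedRep.conj g ρ) δ ↔ ρ.IsTriangulineWith 𝔇 δ :=
  (𝔇.isTriangulineWith_congr (𝔇.Drig_conj g ρ) δ).symm

/-- Frame invariance of triangulinity. [folklore] -/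
lemma isTrianguline_conj_iff (𝔇 : PhiGammaModuleData.{u, v, w} p F E) (g : GL (Fin n) E)
    (ρ : FramedGaloisRep F E n) : IsTrianguline 𝔇 (FramedRep.conj g ρ) ↔ ρ.IsTrianguline 𝔇 :=
  exists_congr fun δ => isTriangulineWith_conj_iff 𝔇 g ρ δ

/-- In `GL_1(R)` the `(0,0)` entry is the determinant, a group homomorphism; used to read off
the scalars of a rank-one framed module after a change of basis. [folklore] -/
private lemma gl_one_apply_eq_det {R : Type*} [CommRing R] (g : GL (Fin 1) R) :
    (g : Matrix (Fin 1) (Fin 1) R) 0 0 = (Matrix.GeneralLinearGroup.det g : R) := by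
  rw [Matrix.GeneralLinearGroup.val_det_apply, Matrix.det_fin_one]

/-- **Non-vacuity: the trivial representation is trianguline with parameter `(1, …, 1)`**, for
EVERY datum `𝔇` (from the axioms `Drig_one` and `charMod_one`: if `e` is the datum's basis
vector of `𝓡(1) ≅ 𝓡` and `u` the unit with `e = u · 1`, the scalar change of basis
`diag(u, …, u)` of `𝓡ⁿ = D_rig^†(1)` is adapted, with diagonal entries `u φ(u)⁻¹`,
`u σ(u)⁻¹`). [folklore] -/
theorem isTriangulineWith_one (𝔇 : PhiGammaModuleData.{u, v, w} p F E) (n : ℕ) :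
    IsTriangulineWith 𝔇 (1 : FramedGaloisRep F E n) (fun _ => 1) := by
  obtain ⟨U, hU⟩ := 𝔇.Drig_one n
  obtain ⟨u, hu⟩ := 𝔇.charMod_one
  -- the unit `u₀ = u 0 0 = det u` and the scalar change of basis `W = diag(u₀⁻¹, …, u₀⁻¹)`
  set u₀ : 𝔇.ring.Rˣ := Matrix.GeneralLinearGroup.det u with hu₀
  set W : GL (Fin n) 𝔇.ring.R :=
    Units.map (Matrix.scalar (Fin n) : 𝔇.ring.R →+* Matrix (Fin n) (Fin n) 𝔇.ring.R).toMonoidHom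
      u₀⁻¹ with hWdef
  have hW : (W : Matrix (Fin n) (Fin n) 𝔇.ring.R) =
      Matrix.diagonal fun _ => ((u₀⁻¹ : 𝔇.ring.Rˣ) : 𝔇.ring.R) := by
    simp [hWdef, Matrix.scalar_apply]
  have hWinv : ((W⁻¹ : GL (Fin n) 𝔇.ring.R) : Matrix (Fin n) (Fin n) 𝔇.ring.R) =
      Matrix.diagonal fun _ => (u₀ : 𝔇.ring.R) := by
    rw [hWdef, ← map_inv, inv_inv]
    simp [Matrix.scalar_apply]
  -- the matrices of `𝓡(1)` in the datum's basis, read off from `charMod_one`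
  have hPhi : (𝔇.charMod 1).matPhi = u * (𝔇.ring.phiGL 1 u)⁻¹ := by
    have h := congrArg FramedPhiGammaModule.matPhi hu
    simp only [FramedPhiGammaModule.trivial_matPhi, FramedPhiGammaModule.conj_matPhi] at h
    calc (𝔇.charMod 1).matPhi
        = u * (u⁻¹ * (𝔇.charMod 1).matPhi * 𝔇.ring.phiGL 1 u) * (𝔇.ring.phiGL 1 u)⁻¹ := by group
      _ = u * (𝔇.ring.phiGL 1 u)⁻¹ := by rw [← h, mul_one]
  have hGamma : ∀ σ, (𝔇.charMod 1).matGamma σ = u * (𝔇.ring.gammaGL 1 σ u)⁻¹ := by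
    intro σ
    have h := congrArg (fun D => FramedPhiGammaModule.matGamma D σ) hu
    simp only [FramedPhiGammaModule.trivial_matGamma, FramedPhiGammaModule.conj_matGamma] at h
    calc (𝔇.charMod 1).matGamma σ
        = u * (u⁻¹ * (𝔇.charMod 1).matGamma σ * 𝔇.ring.gammaGL 1 σ u) *
            (𝔇.ring.gammaGL 1 σ u)⁻¹ := by group
      _ = u * (𝔇.ring.gammaGL 1 σ u)⁻¹ := by rw [← h, mul_one]
  have hcharPhi : 𝔇.charPhi 1 = (u₀ : 𝔇.ring.R) * 𝔇.ring.frob ((u₀⁻¹ : 𝔇.ring.Rˣ) : 𝔇.ring.R) := by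
    simp only [PhiGammaModuleData.charPhi, FramedPhiGammaModule.phiScalar, hPhi,
      gl_one_apply_eq_det, map_mul, map_inv, PhiGammaRing.phiGL,
      Matrix.GeneralLinearGroup.map_det, hu₀, Units.val_mul, Units.coe_map_inv]
    rfl
  have hcharGamma : ∀ σ, 𝔇.charGamma 1 σ =
      (u₀ : 𝔇.ring.R) * σ • ((u₀⁻¹ : 𝔇.ring.Rˣ) : 𝔇.ring.R) := by
    intro σ
    simp only [PhiGammaModuleData.charGamma, FramedPhiGammaModule.gammaScalar, hGamma,
      gl_one_apply_eq_det, map_mul, map_inv, PhiGammaRing.gammaGL,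
      Matrix.GeneralLinearGroup.map_det, hu₀, Units.val_mul, Units.coe_map_inv]
    rfl
  -- the adapted basis of `D_rig^†(1)`
  refine ⟨U * W, ?_⟩
  rw [← FramedPhiGammaModule.conj_conj, ← hU]
  refine ⟨?_, ?_, fun σ => ⟨?_, ?_⟩⟩
  · rw [FramedPhiGammaModule.conj_matPhi, FramedPhiGammaModule.trivial_matPhi, mul_one,
      Matrix.GeneralLinearGroup.coe_mul, hWinv, PhiGammaRing.coe_phiGL, hW,
      Matrix.diagonal_map (map_zero _), Matrix.diagonal_mul_diagonal]
    exact Matrix.blockTriangular_diagonal _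
  · intro i
    rw [FramedPhiGammaModule.conj_matPhi, FramedPhiGammaModule.trivial_matPhi, mul_one,
      Matrix.GeneralLinearGroup.coe_mul, hWinv, PhiGammaRing.coe_phiGL, hW,
      Matrix.diagonal_map (map_zero _), Matrix.diagonal_mul_diagonal, Matrix.diagonal_apply_eq]
    exact hcharPhi.symm
  · rw [FramedPhiGammaModule.conj_matGamma, FramedPhiGammaModule.trivial_matGamma, mul_one,
      Matrix.GeneralLinearGroup.coe_mul, hWinv, PhiGammaRing.coe_gammaGL, hW,
      Matrix.diagonal_map (map_zero _), Matrix.diagonal_mul_diagonal]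
    exact Matrix.blockTriangular_diagonal _
  · intro i
    rw [FramedPhiGammaModule.conj_matGamma, FramedPhiGammaModule.trivial_matGamma, mul_one,
      Matrix.GeneralLinearGroup.coe_mul, hWinv, PhiGammaRing.coe_gammaGL, hW,
      Matrix.diagonal_map (map_zero _), Matrix.diagonal_mul_diagonal, Matrix.diagonal_apply_eq]
    exact (hcharGamma σ).symm

/-- The trivial representation is trianguline for every datum. [folklore] -/
theorem isTrianguline_one (𝔇 : PhiGammaModuleData.{u, v, w} p F E) (n : ℕ) :
    IsTrianguline 𝔇 (1 : FramedGaloisRep F E n) :=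
  ⟨fun _ => 1, isTriangulineWith_one 𝔇 n⟩

/-- **Characters are trianguline**: every `η : Γ_F^abs →ₜ* GL_1(E)` is trianguline, with
parameter the `δ` of `Drig_rank_one` (`D_rig^†(η) ≅ 𝓡(δ)`; Hansen §6.1, KPX Thm. 6.2.14). [folklore] -/
theorem isTrianguline_of_rank_one (𝔇 : PhiGammaModuleData.{u, v, w} p F E)
    (η : FramedGaloisRep F E 1) : η.IsTrianguline 𝔇 := by
  obtain ⟨δ, U, hU⟩ := 𝔇.Drig_rank_one η
  refine ⟨fun _ => δ, U, ?_⟩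
  rw [← hU]
  have htri : ∀ M : Matrix (Fin 1) (Fin 1) 𝔇.ring.R, M.BlockTriangular id :=
    fun M i j hij => absurd hij (by simp [Subsingleton.elim i j])
  refine ⟨htri _, fun i => ?_, fun σ => ⟨htri _, fun i => ?_⟩⟩
  · rw [Subsingleton.elim i 0]; rfl
  · rw [Subsingleton.elim i 0]; rfl

end Local

/-! ### `TriangulineAt`: global representations over `ℚ̄_p` at a place `v` -/

section Global

variable {K : Type} [Field K] [NumberField K] {p : ℕ} [Fact p.Prime] {n : ℕ}

/-- **`ρ : Γ_K →ₜ* GL_n(ℚ̄_p)` is trianguline at the finite place `v`** (intended: `v ∣ p`),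
relative to a family `𝔇` of `(φ, Γ)`-module data for `K_v = v.adicCompletion K` over the finite
extensions `E ⊆ ℚ̄_p` of `ℚ_p` (intended: the Robba rings `𝓡_{E,K_v}` with `D_rig^†`, see
`PhiGammaModuleData.nonempty`): the local representation `ρ|_{Γ_{K_v}}` (accepted
`FramedGaloisRep.toLocal`) has a model `rE : Γ_{K_v} →ₜ* GL_n(E)` over some finite `E/ℚ_p`
(accepted `HasQlModel`; such models always exist, accepted fact `exists_hasQlModel`) whose
`(φ, Γ_{K_v})`-module is trianguline with `E`-valued parameters. The existential over `E` is
"after perhaps enlarging `L`" (KPX Def. 6.3.1) / "`L` sufficiently large" (Hansen §1.4);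
Hansen §1.2: "`ρ` is trianguline at all places dividing `p`", Conj. 1.2.3.
[cite: HansenUniversalEigenvarieties2017, §1.2 Conj. 1.2.3 and Def. 6.1.4] -/
def TriangulineAt (v : HeightOneSpectrum (𝓞 K))
    (𝔇 : ∀ E : IntermediateField ℚ_[p] (PadicAlgCl p), FiniteDimensional ℚ_[p] E →
      PhiGammaModuleData.{0, 0, 0} p (v.adicCompletion K) E)
    (ρ : FramedGaloisRep K (PadicAlgCl p) n) : Prop :=
  ∃ (E : IntermediateField ℚ_[p] (PadicAlgCl p)) (hE : FiniteDimensional ℚ_[p] E)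
    (rE : FramedGaloisRep (v.adicCompletion K) E n),
    Literature.NumberTheory.Automorphic.HasQlModel (ρ.toLocal v) E rE ∧ rE.IsTrianguline (𝔇 E hE)

/-- **`δ` is a parameter of `ρ` at `v`** (`δᵢ : K_v× → ℚ̄_p×` continuous; Hansen §1.2,
`Par(ρ) ⊂ T̂(ℚ̄_p)`): some model `rE` of `ρ|_{Γ_{K_v}}` over a finite `E/ℚ_p` is trianguline
with an `E`-valued parameter `δE` whose composite with `E ⊆ ℚ̄_p` is `δ`.
[cite: HansenUniversalEigenvarieties2017, §1.2] -/
def HasParameterAt (v : HeightOneSpectrum (𝓞 K))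
    (𝔇 : ∀ E : IntermediateField ℚ_[p] (PadicAlgCl p), FiniteDimensional ℚ_[p] E →
      PhiGammaModuleData.{0, 0, 0} p (v.adicCompletion K) E)
    (ρ : FramedGaloisRep K (PadicAlgCl p) n)
    (δ : Fin n → ((v.adicCompletion K)ˣ →ₜ* (PadicAlgCl p)ˣ)) : Prop :=
  ∃ (E : IntermediateField ℚ_[p] (PadicAlgCl p)) (hE : FiniteDimensional ℚ_[p] E)
    (rE : FramedGaloisRep (v.adicCompletion K) E n) (δE : Fin n → ((v.adicCompletion K)ˣ →ₜ* Eˣ)),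
    Literature.NumberTheory.Automorphic.HasQlModel (ρ.toLocal v) E rE ∧
      rE.IsTriangulineWith (𝔇 E hE) δE ∧
        ∀ (i : Fin n) (x : (v.adicCompletion K)ˣ),
          ((δ i x : (PadicAlgCl p)ˣ) : PadicAlgCl p) = algebraMap E (PadicAlgCl p) (δE i x : Eˣ)

/-- A representation with a parameter at `v` is trianguline at `v`. [folklore] -/
lemma HasParameterAt.triangulineAt {v : HeightOneSpectrum (𝓞 K)}
    {𝔇 : ∀ E : IntermediateField ℚ_[p] (PadicAlgCl p), FiniteDimensional ℚ_[p] E →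
      PhiGammaModuleData.{0, 0, 0} p (v.adicCompletion K) E}
    {ρ : FramedGaloisRep K (PadicAlgCl p) n}
    {δ : Fin n → ((v.adicCompletion K)ˣ →ₜ* (PadicAlgCl p)ˣ)} (h : ρ.HasParameterAt v 𝔇 δ) :
    ρ.TriangulineAt v 𝔇 := by
  obtain ⟨E, hE, rE, δE, hmodel, htri, -⟩ := h
  exact ⟨E, hE, rE, hmodel, δE, htri⟩

/-- Conversely, a representation trianguline at `v` has a (`ℚ̄_p`-valued) parameter at `v`:
push an `E`-valued parameter forward along the continuous inclusion `E ⊆ ℚ̄_p`. [folklore] -/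
lemma TriangulineAt.exists_hasParameterAt {v : HeightOneSpectrum (𝓞 K)}
    {𝔇 : ∀ E : IntermediateField ℚ_[p] (PadicAlgCl p), FiniteDimensional ℚ_[p] E →
      PhiGammaModuleData.{0, 0, 0} p (v.adicCompletion K) E}
    {ρ : FramedGaloisRep K (PadicAlgCl p) n} (h : ρ.TriangulineAt v 𝔇) :
    ∃ δ : Fin n → ((v.adicCompletion K)ˣ →ₜ* (PadicAlgCl p)ˣ), ρ.HasParameterAt v 𝔇 δ := by
  obtain ⟨E, hE, rE, hmodel, δE, htri⟩ := h
  let ι : Eˣ →ₜ* (PadicAlgCl p)ˣ :=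
    ⟨Units.map (algebraMap E (PadicAlgCl p)).toMonoidHom,
      Continuous.units_map _ (by exact continuous_subtype_val)⟩
  exact ⟨fun i => ι.comp (δE i), E, hE, rE, δE, hmodel, htri, fun i x => rfl⟩

/-- `ρ` is trianguline at `v` iff it has a parameter at `v` (Hansen §1.2: `Par(ρ) ≠ ∅` iff
`ρ|_{G_{F_v}}` is trianguline). [folklore] -/
theorem triangulineAt_iff_exists_hasParameterAt (v : HeightOneSpectrum (𝓞 K))
    (𝔇 : ∀ E : IntermediateField ℚ_[p] (PadicAlgCl p), FiniteDimensional ℚ_[p] E →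
      PhiGammaModuleData.{0, 0, 0} p (v.adicCompletion K) E)
    (ρ : FramedGaloisRep K (PadicAlgCl p) n) :
    ρ.TriangulineAt v 𝔇 ↔
      ∃ δ : Fin n → ((v.adicCompletion K)ˣ →ₜ* (PadicAlgCl p)ˣ), ρ.HasParameterAt v 𝔇 δ :=
  ⟨TriangulineAt.exists_hasParameterAt, fun ⟨_, h⟩ => h.triangulineAt⟩

end Global

end FramedGaloisRep

/-! ### Existence of the genuine datum (named fact) -/

/-- **The genuine `(φ, Γ)`-module data exist** in the form `TriangulineAt` consumes: for a
number field `K`, a prime `p`, a place `v ∣ p` (so `K_v/ℚ_p` is finite) and a finite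
`E ⊆ ℚ̄_p`, the Robba ring `𝓡_{E,K_v}` with `φ` and `Γ_{K_v}` (KPX Def. 2.2.2), Berger's
`D_rig^†` in chosen bases (free: KPX Rem. 2.2.16; functorial: Thm. 2.2.17) and KPX's `𝓡(δ)`
(Construction 6.2.4; `δ` unique: Thm. 6.2.14 (2)) satisfy the axioms of
`PhiGammaModuleData p K_v E`. Named fact (D-0014). Its Lean content is weak — the type also has
junk inhabitants — and, as `PstWeilDeligneData.nonempty`, it is the placeholder target of the
definition items "construct the Robba ring `𝓡_{E,F}`" and "construct `D_rig^†`", which replace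
the abstract fields by the genuine objects. [cite: KedlayaPottharstXiao2014, Thm. 2.2.17 and Thm. 6.2.14] -/
def PhiGammaModuleData.nonempty : Prop :=
  ∀ (K : Type) [Field K] [NumberField K] (p : ℕ) [Fact p.Prime] (v : HeightOneSpectrum (𝓞 K)),
    ((p : ℕ) : 𝓞 K) ∈ v.asIdeal →
      ∀ E : IntermediateField ℚ_[p] (PadicAlgCl p), FiniteDimensional ℚ_[p] E →
        Nonempty (PhiGammaModuleData.{0, 0, 0} p (v.adicCompletion K) E)

end Literature.NumberTheory.GaloisRepresentations

end
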